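import Summits.Ventures.LatticeQCDFlow.Exactness.Phi4FlowSquareIntegrableAcceptanceCeiling
import Summits.Ventures.LatticeQCDFlow.Scoring.ModelDensityPairLaw
import Mathlib.Probability.Independence.Integration
import HarnessLib

/-!
# Weight-blind observables of the exact flow sampler on a general space: the sampler acts
# diagonally, `C_g(k) = Var_q(g)·E_w[rᵏ]`, and `τ_int = E_π[1/ρ] − ½` EXACTLY — the same for all of them

HONEST FRAMING: exact (Metropolis-corrected) sampling algorithms for lattice gauge theory;
figures of merit are autocorrelation/cost numbers at stated couplings and volumes; no
continuum-physics claim.  (SCALAR calibration rung S0-A: not a gauge result.)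

Venture `LatticeQCDFlow` (cell pub-lqcd), topic `Exactness`; FANOUT row 2 (`s0-phi4`, FLOW arm
`K = imhOp μ w q̃`).  NEW WORK of the cell (elementary; Mathlib's independence API; nothing cited as a
fact; Liu 1996's eigen-analysis NAMED).  Rows 3/8 typed, on FINITE product spaces, that an
observable which does not see the importance weight has `τ_int = E_p[1/a(W)] − ½` and
`1/ESS − ½ ≤ τ_int ≤ 2/ESS − ½` (`Scoring/IMHWeightBlindTau`, `Scoring/IMHWeightBlindTauESS`).  Here
the same law on a GENERAL measurable space in row 2's vocabulary, by the mechanism of the tree's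
`FlowSamplerOddObservableExact`: the jump part of `K` vanishes on such observables, so `K` acts
DIAGONALLY (`K g = r·g`).  Between the two extremes of this session's group (`σ²_RW ≤ σ²_chain`
always, `FlowSamplerVsReweighting`; no converse, `…Witness`), weight-blind observables are the
class on which the two estimators are within the factor `[2 − κ, 4 − κ]` of each other.

## Setting

`(X, μ)` s-finite; `w, q > 0` measurable integrable, `∫ q = 1`, `Z = ∫ w`, `b = w/q`,
`W₂ = ∫ b w`, `κ = Z²/W₂`; `r(t)` the rejection probability of `K` from `t`, `ρ = 1 − r`.  A LEVEL
STATISTIC `ℓ : X → L` (measurable, any measurable space `L`) through which the weight factors,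
`b = β ∘ ℓ` (`β` measurable).  A bounded measurable observable `g` is WEIGHT-BLIND if it is
independent of `ℓ` under the model law `q dμ` (Mathlib's `IndepFun g ℓ`) and centred under the model
(`∫ g q = 0`; then also `∫ g w = 0`).  Example: `X = L × Y`, `w = p_L ⊗ m`, `q = q_L ⊗ m` (the flow
is exact on the `Y`-marginal), `g(l, y) = h(y)` with `∫ h m = 0`.

## What is proved

* (`∫ F d(qμ) = ∫ F q dμ` is row 4's `Scoring.AllPairsVariance.integral_withDensity_eq'`, reused) **`imh_jump_levelMul_eq_zero`** — for every bounded measurable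
  `ψ : L → ℝ` and every `t`: `∫ α(t,t') ψ(ℓ t') g(t') q(t') dμ(t') = 0`;
* **`imhOp_levelMul_weightBlind`** — `K (ψ∘ℓ · g) = r · (ψ∘ℓ · g)`; **`imhOp_iterate_weightBlind`** —
  `Kᵏ g = rᵏ g`; **`autocov_weightBlind`** — `∫ g (Kᵏg) w = (∫ g² q)·(∫ w rᵏ)` (a PRODUCT: the
  observable's model variance times the target's `k`-th sticking moment); `sqNorm_weightBlind` —
  `∫ g² w = (∫ g² q)·Z`;
* `hasSum_weight_stickingMoments` — `w r/(1−r) ∈ L¹ ⇒ Σ_{k≥0} ∫ w r^{k+1} = ∫ w r/(1 − r)`;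
  **`tauInt_weightBlind_eq`** — `∫ g² q > 0`, `w r/(1−r) ∈ L¹` ⇒ the series of `g` is summable and
  `τ_int(g) = ½ + (∫ w r/(1−r))/Z = E_π[1/ρ] − ½`, THE SAME FOR EVERY weight-blind `g`;
* the sequel `FlowSamplerWeightBlindKishBounds` (same session; filed once this module is built) adds,
  under `W₂ < ∞`: `1/κ − ½ ≤ τ_int(g) ≤ 2/κ − ½`, `σ²_RW(g) = Var_π(g)/κ` exactly, and
  `(2 − κ)·σ²_RW ≤ σ²_chain ≤ (4 − κ)·σ²_RW`.

Reading for S0-A (no numerics implied): on observables blind to the model error the exact chain's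
`τ_int` IS the inverse Kish fraction up to a factor in `[1, 2]`, whatever the flow, and the chain
costs between `2 − κ` and `4 − κ` times the reweighting variance per draw; the observable-specific
extremes (unbounded either way) need observables correlated with the weight (`…Witness`,
`FlowSamplerKishFractionScope`).  NOT CLAIMED: that lattice observables of interest are weight-blind
for a trained flow (they are not, in general); square-integrable unbounded `g`; values for any run.
-/

namespace Summit.Ventures.LatticeQCDFlow.Exactness

open Real MeasureTheory ProbabilityTheory Filter Finset Set Topology
open Summit.Ventures.LatticeQCDFlow.Scoring

section General

variable {X : Type*} [MeasurableSpace X] {μ : Measure X} {w q : X → ℝ}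
  {L : Type*} [MeasurableSpace L] {ℓ : X → L} {β : L → ℝ}

/-! ## §1 The model law `q dμ` and the vanishing jump part -/

/-- **THE JUMP PART VANISHES ON WEIGHT-BLIND OBSERVABLES**: if `b = β ∘ ℓ`, `g` is bounded measurable,
independent of `ℓ` under `q μ` and centred under `q μ`, then for every bounded measurable `ψ : L → ℝ`
and every state `t`: `∫ α(t,t') ψ(ℓ t') g(t') q(t') dμ(t') = 0` — the acceptance `α(t,t')` is a
function of `ℓ t'`, and `E_q[(φ∘ℓ) · g] = E_q[φ∘ℓ] · E_q[g] = 0`. -/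
theorem imh_jump_levelMul_eq_zero (hw0 : ∀ t, 0 < w t) (hq0 : ∀ t, 0 < q t) (hqm : Measurable q)
    (hℓ : Measurable ℓ) (hβm : Measurable β)
    (hb : ∀ x, w x / q x = β (ℓ x)) {g : X → ℝ} (hgm : Measurable g)
    (hind : IndepFun g ℓ (μ.withDensity fun z => ENNReal.ofReal (q z)))
    (hg0 : ∫ x, g x * q x ∂μ = 0) {ψ : L → ℝ} (hψm : Measurable ψ) (t : X) :
    ∫ t', imhAcceptQ w q t t' * (ψ (ℓ t') * g t') * q t' ∂μ = 0 := by
  -- `α(t,t') = min(1, β(ℓ t')/β(ℓ t))`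
  have hα : ∀ t', imhAcceptQ w q t t' = min 1 (β (ℓ t') / β (ℓ t)) := by
    intro t'
    unfold imhAcceptQ
    rw [← hb t, ← hb t']
    congr 1
    field_simp [(hw0 t).ne', (hq0 t).ne', (hq0 t').ne']
  set φ : L → ℝ := fun l => min 1 (β l / β (ℓ t)) * ψ l with hφ
  have hφm : Measurable φ := (measurable_const.min (hβm.div_const _)).mul hψm
  have e : (fun t' => imhAcceptQ w q t t' * (ψ (ℓ t') * g t') * q t')
      = fun t' => (g t' * φ (ℓ t')) * q t' := by
    funext t'; rw [hα t']; simp only [hφ]; ring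
  rw [e, ← AllPairsVariance.integral_withDensity_eq' (fun y => (hq0 y).le) hqm]
  have h := hind.integral_fun_comp_mul_comp (f := fun s : ℝ => s) (g := φ) hgm.aemeasurable
    hℓ.aemeasurable measurable_id.aestronglyMeasurable hφm.aestronglyMeasurable
  rw [h, AllPairsVariance.integral_withDensity_eq' (fun y => (hq0 y).le) hqm, hg0, zero_mul]

/-! ## §2 The sampler acts diagonally on weight-blind observables -/

variable [SFinite μ]

omit [SFinite μ] in
/-- **`K (ψ∘ℓ · g) = r · (ψ∘ℓ · g)`** for every bounded measurable `ψ : L → ℝ` (weight-blind bounded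
`g`): an accepted proposal forgets `g`, a rejected one keeps it. -/
theorem imhOp_levelMul_weightBlind (hw0 : ∀ t, 0 < w t) (hwm : Measurable w) (hq0 : ∀ t, 0 < q t)
    (hqm : Measurable q) (hqi : Integrable q μ) (hℓ : Measurable ℓ) (hβm : Measurable β)
    (hb : ∀ x, w x / q x = β (ℓ x)) {g : X → ℝ} (hgm : Measurable g) {B : ℝ} (hgb : ∀ t, |g t| ≤ B)
    (hind : IndepFun g ℓ (μ.withDensity fun z => ENNReal.ofReal (q z)))
    (hg0 : ∫ x, g x * q x ∂μ = 0) {ψ : L → ℝ} (hψm : Measurable ψ) {Bψ : ℝ} (hψb : ∀ l, |ψ l| ≤ Bψ)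
    (t : X) :
    imhOp μ w q (fun x => ψ (ℓ x) * g x) t
      = (∫ t', (1 - imhAcceptQ w q t t') * q t' ∂μ) * (ψ (ℓ t) * g t) := by
  unfold imhOp
  have hαq := integrable_imhAcceptQ_mul hw0 hwm hq0 hqm hqi t
  have h1q := integrable_one_sub_imhAcceptQ_mul hw0 hwm hq0 hqm hqi t
  have hα01 : ∀ t', 0 ≤ imhAcceptQ w q t t' ∧ imhAcceptQ w q t t' ≤ 1 :=
    fun t' => ⟨imhAcceptQ_nonneg hw0 hq0 t t', imhAcceptQ_le_one w q t t'⟩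
  -- the jump integrand is dominated by `B Bψ · α q`
  have hjump : Integrable (fun t' => imhAcceptQ w q t t' * (ψ (ℓ t') * g t') * q t') μ := by
    refine Integrable.mono' (hαq.const_mul (Bψ * B))
      ((((measurable_imhAcceptQ hwm hqm).comp (measurable_const.prodMk measurable_id)).mul
        ((hψm.comp hℓ).mul hgm)).mul hqm).aestronglyMeasurable (Eventually.of_forall fun t' => ?_)
    rw [Real.norm_eq_abs, abs_mul, abs_mul, abs_of_nonneg (hα01 t').1, abs_of_pos (hq0 t'), abs_mul]
    have hB0 : 0 ≤ B := (abs_nonneg _).trans (hgb t')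
    have := mul_le_mul (hψb (ℓ t')) (hgb t') (abs_nonneg _) ((abs_nonneg _).trans (hψb (ℓ t')))
    calc imhAcceptQ w q t t' * (|ψ (ℓ t')| * |g t'|) * q t'
        ≤ imhAcceptQ w q t t' * (Bψ * B) * q t' :=
          mul_le_mul_of_nonneg_right (mul_le_mul_of_nonneg_left this (hα01 t').1) (hq0 t').le
      _ = Bψ * B * (imhAcceptQ w q t t' * q t') := by ring
  have e : (fun t' => (imhAcceptQ w q t t' * (ψ (ℓ t') * g t')
      + (1 - imhAcceptQ w q t t') * (ψ (ℓ t) * g t)) * q t')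
      = fun t' => imhAcceptQ w q t t' * (ψ (ℓ t') * g t') * q t'
        + (ψ (ℓ t) * g t) * ((1 - imhAcceptQ w q t t') * q t') := by
    funext t'; ring
  rw [e, integral_add hjump (h1q.const_mul _), integral_const_mul,
    imh_jump_levelMul_eq_zero hw0 hq0 hqm hℓ hβm hb hgm hind hg0 hψm t]
  ring

/-- **`Kᵏ g = rᵏ · g`** for a weight-blind bounded `g` (`r = λ ∘ β ∘ ℓ` is itself a bounded function
of the level, so `rᵏ g` stays in the class). -/
theorem imhOp_iterate_weightBlind (hw0 : ∀ t, 0 < w t) (hwm : Measurable w) (hq0 : ∀ t, 0 < q t)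
    (hqm : Measurable q) (hqi : Integrable q μ) (hq1 : ∫ z, q z ∂μ = 1) (hℓ : Measurable ℓ)
    (hβm : Measurable β) (hb : ∀ x, w x / q x = β (ℓ x)) {g : X → ℝ} (hgm : Measurable g) {B : ℝ}
    (hgb : ∀ t, |g t| ≤ B) (hind : IndepFun g ℓ (μ.withDensity fun z => ENNReal.ofReal (q z)))
    (hg0 : ∫ x, g x * q x ∂μ = 0) (k : ℕ) (t : X) :
    ((imhOp μ w q)^[k] g) t = (∫ t', (1 - imhAcceptQ w q t t') * q t' ∂μ) ^ k * g t := by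
  -- `r = λ(β(ℓ ·))`, and the CLAMPED curve `l ↦ max 0 (min 1 (λ(β l)))` is a bounded measurable
  -- function of the level agreeing with it on the range of `ℓ` (`0 ≤ λ ≤ 1` at positive weights)
  obtain ⟨hr0, hr1, -⟩ := rejection_bounds (μ := μ) hw0 hwm hq0 hqm hqi hq1
  have hrm : Measurable (rejCurve μ w q) := measurable_rejCurve hwm hqm
  set rc : L → ℝ := fun l => max 0 (min 1 (rejCurve μ w q (β l))) with hrc
  have hrcm : Measurable rc := measurable_const.max (measurable_const.min (hrm.comp hβm))
  have hrc01 : ∀ l, 0 ≤ rc l ∧ rc l ≤ 1 := fun l =>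
    ⟨le_max_left _ _, max_le zero_le_one (min_le_left _ _)⟩
  have hr : ∀ s, (∫ t', (1 - imhAcceptQ w q s t') * q t' ∂μ) = rc (ℓ s) := fun s => by
    have h0 := hr0 s
    have h1 := hr1 s
    rw [rejection_eq_rejCurve hw0 hq0 s, hb s] at h0 h1 ⊢
    simp only [hrc]
    rw [min_eq_right h1, max_eq_right h0]
  induction k generalizing t with
  | zero => simp
  | succ k ih =>
    have e : (imhOp μ w q)^[k] g = fun s => rc (ℓ s) ^ k * g s := by
      funext s; rw [ih s, hr s]
    rw [Function.iterate_succ_apply', e,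
      imhOp_levelMul_weightBlind hw0 hwm hq0 hqm hqi hℓ hβm hb hgm hgb hind hg0
        (ψ := fun l => rc l ^ k) (hrcm.pow_const k) (Bψ := 1)
        (fun l => by rw [abs_pow, abs_of_nonneg (hrc01 l).1]; exact pow_le_one₀ (hrc01 l).1 (hrc01 l).2)
        t, hr t]
    ring

/-! ## §3 Autocovariances factor: `C_g(k) = (∫ g² q)·(∫ w rᵏ)`, and `τ_int = E_π[1/ρ] − ½` -/

omit [SFinite μ] in
/-- `∫ g² φ(ℓ) q = (∫ g² q)(∫ φ(ℓ) q)` for a weight-blind `g` and measurable `φ` (independence). -/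
theorem integral_sq_levelFun_weightBlind (hq0 : ∀ t, 0 < q t) (hqm : Measurable q)
    (hℓ : Measurable ℓ) {g : X → ℝ} (hgm : Measurable g)
    (hind : IndepFun g ℓ (μ.withDensity fun z => ENNReal.ofReal (q z))) {φ : L → ℝ}
    (hφm : Measurable φ) :
    ∫ x, g x ^ 2 * φ (ℓ x) * q x ∂μ = (∫ x, g x ^ 2 * q x ∂μ) * ∫ x, φ (ℓ x) * q x ∂μ := by
  have h := hind.integral_fun_comp_mul_comp (f := fun s : ℝ => s ^ 2) (g := φ) hgm.aemeasurable
    hℓ.aemeasurable (measurable_id.pow_const 2).aestronglyMeasurable hφm.aestronglyMeasurable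
  rw [AllPairsVariance.integral_withDensity_eq' (fun y => (hq0 y).le) hqm, AllPairsVariance.integral_withDensity_eq' (fun y => (hq0 y).le) hqm, AllPairsVariance.integral_withDensity_eq' (fun y => (hq0 y).le) hqm] at h
  exact h

/-- **`∫ g (Kᵏ g) w = (∫ g² q)·(∫ w rᵏ)`** — every autocovariance of a weight-blind bounded observable is
its MODEL variance times the target's `k`-th sticking moment (`w = β(ℓ) q` and independence). -/
theorem autocov_weightBlind (hw0 : ∀ t, 0 < w t) (hwm : Measurable w)
    (hq0 : ∀ t, 0 < q t) (hqm : Measurable q) (hqi : Integrable q μ) (hq1 : ∫ z, q z ∂μ = 1)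
    (hℓ : Measurable ℓ) (hβm : Measurable β) (hb : ∀ x, w x / q x = β (ℓ x)) {g : X → ℝ}
    (hgm : Measurable g) {B : ℝ} (hgb : ∀ t, |g t| ≤ B)
    (hind : IndepFun g ℓ (μ.withDensity fun z => ENNReal.ofReal (q z)))
    (hg0 : ∫ x, g x * q x ∂μ = 0) (k : ℕ) :
    ∫ t, g t * ((imhOp μ w q)^[k] g) t * w t ∂μ
      = (∫ x, g x ^ 2 * q x ∂μ)
        * ∫ t, w t * (∫ t', (1 - imhAcceptQ w q t t') * q t' ∂μ) ^ k ∂μ := by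
  obtain ⟨hr0, hr1, -⟩ := rejection_bounds (μ := μ) hw0 hwm hq0 hqm hqi hq1
  have hrm : Measurable (rejCurve μ w q) := measurable_rejCurve hwm hqm
  -- the clamped curve of the level, as in `imhOp_iterate_weightBlind`
  set rc : L → ℝ := fun l => max 0 (min 1 (rejCurve μ w q (β l))) with hrc
  have hrcm : Measurable rc := measurable_const.max (measurable_const.min (hrm.comp hβm))
  have hr : ∀ s, (∫ t', (1 - imhAcceptQ w q s t') * q t' ∂μ) = rc (ℓ s) := fun s => by
    have h0 := hr0 s
    have h1 := hr1 s
    rw [rejection_eq_rejCurve hw0 hq0 s, hb s] at h0 h1 ⊢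
    simp only [hrc]
    rw [min_eq_right h1, max_eq_right h0]
  have hwq : ∀ x, w x = β (ℓ x) * q x := fun x => by
    rw [← hb x, div_mul_cancel₀ _ (hq0 x).ne']
  -- both sides as `q μ`-integrals of `g² · (rcᵏ β)(ℓ)`
  have e1 : (fun t => g t * ((imhOp μ w q)^[k] g) t * w t)
      = fun t => g t ^ 2 * ((fun l => rc l ^ k * β l) (ℓ t)) * q t := by
    funext t
    rw [imhOp_iterate_weightBlind hw0 hwm hq0 hqm hqi hq1 hℓ hβm hb hgm hgb hind hg0 k t, hr t, hwq t]
    ring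
  have e2 : (fun t => w t * (∫ t', (1 - imhAcceptQ w q t t') * q t' ∂μ) ^ k)
      = fun t => (fun l => rc l ^ k * β l) (ℓ t) * q t := by
    funext t; rw [hr t, hwq t]; ring
  rw [e1, e2]
  exact integral_sq_levelFun_weightBlind hq0 hqm hℓ hgm hind ((hrcm.pow_const k).mul hβm)

/-- `∫ g² w = (∫ g² q)·Z` for a weight-blind `g` (the case `k = 0`). -/
theorem sqNorm_weightBlind (hw0 : ∀ t, 0 < w t) (hwm : Measurable w)
    (hq0 : ∀ t, 0 < q t) (hqm : Measurable q) (hqi : Integrable q μ) (hq1 : ∫ z, q z ∂μ = 1)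
    (hℓ : Measurable ℓ) (hβm : Measurable β) (hb : ∀ x, w x / q x = β (ℓ x)) {g : X → ℝ}
    (hgm : Measurable g) {B : ℝ} (hgb : ∀ t, |g t| ≤ B)
    (hind : IndepFun g ℓ (μ.withDensity fun z => ENNReal.ofReal (q z)))
    (hg0 : ∫ x, g x * q x ∂μ = 0) :
    ∫ t, g t ^ 2 * w t ∂μ = (∫ x, g x ^ 2 * q x ∂μ) * ∫ t, w t ∂μ := by
  have h := autocov_weightBlind hw0 hwm hq0 hqm hqi hq1 hℓ hβm hb hgm hgb hind hg0 0
  simp only [Function.iterate_zero, id_eq, pow_zero, mul_one] at h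
  rw [← h]
  exact integral_congr_ae (Eventually.of_forall fun t => by ring)

/-- **`Σ_{k≥0} ∫ w r^{k+1} = ∫ w r/(1 − r)`** as a `HasSum`, whenever `w r/(1−r) ∈ L¹` (`r < 1`
everywhere; dominated convergence of the geometric partial sums). -/
theorem hasSum_weight_stickingMoments (hw0 : ∀ t, 0 < w t) (hwm : Measurable w) (hwi : Integrable w μ)
    (hq0 : ∀ t, 0 < q t) (hqm : Measurable q) (hqi : Integrable q μ) (hq1 : ∫ z, q z ∂μ = 1)
    (hS : Integrable (fun t => w t * ((∫ t', (1 - imhAcceptQ w q t t') * q t' ∂μ)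
      / (1 - ∫ t', (1 - imhAcceptQ w q t t') * q t' ∂μ))) μ) :
    HasSum (fun k => ∫ t, w t * (∫ t', (1 - imhAcceptQ w q t t') * q t' ∂μ) ^ (k + 1) ∂μ)
      (∫ t, w t * ((∫ t', (1 - imhAcceptQ w q t t') * q t' ∂μ)
        / (1 - ∫ t', (1 - imhAcceptQ w q t t') * q t' ∂μ)) ∂μ) := by
  obtain ⟨hr0, hr1, hrm⟩ := rejection_bounds (μ := μ) hw0 hwm hq0 hqm hqi hq1
  set r : X → ℝ := fun t => ∫ t', (1 - imhAcceptQ w q t t') * q t' ∂μ with hr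
  have hrlt : ∀ t, r t < 1 := fun t => by
    show (∫ t', (1 - imhAcceptQ w q t t') * q t' ∂μ) < 1
    rw [rejection_eq_rejCurve hw0 hq0 t]
    exact rejCurve_lt_one hw0 hwm hq0 hqm hqi hq1 (div_pos (hw0 t) (hq0 t))
  have hgeo : ∀ t, HasSum (fun k => r t ^ (k + 1)) (r t / (1 - r t)) := by
    intro t
    have h := (hasSum_geometric_of_lt_one (hr0 t) (hrlt t)).mul_left (r t)
    have e : r t * (1 - r t)⁻¹ = r t / (1 - r t) := by rw [div_eq_mul_inv]
    rw [e] at h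
    exact h.congr_fun fun k => by ring
  have hnn : ∀ k, 0 ≤ ∫ t, w t * r t ^ (k + 1) ∂μ := fun k =>
    integral_nonneg fun t => mul_nonneg (hw0 t).le (pow_nonneg (hr0 t) _)
  have hterm_int : ∀ k, Integrable (fun t => w t * r t ^ (k + 1)) μ := by
    intro k
    refine Integrable.mono' hwi (hwm.mul (hrm.pow_const _)).aestronglyMeasurable
      (Eventually.of_forall fun t => ?_)
    rw [Real.norm_eq_abs, abs_of_nonneg (mul_nonneg (hw0 t).le (pow_nonneg (hr0 t) _))]
    exact mul_le_of_le_one_right (hw0 t).le (pow_le_one₀ (hr0 t) (hr1 t))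
  rw [hasSum_iff_tendsto_nat_of_nonneg hnn]
  have hpart : ∀ N, ∑ k ∈ Finset.range N, ∫ t, w t * r t ^ (k + 1) ∂μ
      = ∫ t, w t * ∑ k ∈ Finset.range N, r t ^ (k + 1) ∂μ := by
    intro N
    rw [← integral_finsetSum _ fun k _ => hterm_int k]
    refine integral_congr_ae (Eventually.of_forall fun t => ?_)
    simp only [Finset.mul_sum]
  simp_rw [hpart]
  refine tendsto_integral_of_dominated_convergence (fun t => w t * (r t / (1 - r t)))
    (fun N => (hwm.mul (Finset.measurable_sum _ fun k _ => hrm.pow_const _)).aestronglyMeasurable) hS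
    (fun N => Eventually.of_forall fun t => ?_) (Eventually.of_forall fun t => ?_)
  · have hs0 : 0 ≤ ∑ k ∈ Finset.range N, r t ^ (k + 1) := Finset.sum_nonneg fun k _ => pow_nonneg (hr0 t) _
    rw [Real.norm_eq_abs, abs_of_nonneg (mul_nonneg (hw0 t).le hs0)]
    refine mul_le_mul_of_nonneg_left ?_ (hw0 t).le
    exact sum_le_hasSum (Finset.range N) (fun k _ => pow_nonneg (hr0 t) _) (hgeo t)
  · exact ((hgeo t).tendsto_sum_nat).const_mul _

/-- **`τ_int(g) = ½ + (∫ w r/(1−r))/Z = E_π[1/ρ] − ½` FOR EVERY WEIGHT-BLIND BOUNDED OBSERVABLE**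
(`∫ g² q > 0`, `w r/(1−r) ∈ L¹`): the series is summable and the integrated autocorrelation time is
the target-mean rejection odds plus one half — the same number for every such `g`. -/
theorem tauInt_weightBlind_eq (hw0 : ∀ t, 0 < w t) (hwm : Measurable w) (hwi : Integrable w μ)
    (hq0 : ∀ t, 0 < q t) (hqm : Measurable q) (hqi : Integrable q μ) (hq1 : ∫ z, q z ∂μ = 1)
    (hℓ : Measurable ℓ) (hβm : Measurable β) (hb : ∀ x, w x / q x = β (ℓ x)) {g : X → ℝ}
    (hgm : Measurable g) {B : ℝ} (hgb : ∀ t, |g t| ≤ B)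
    (hind : IndepFun g ℓ (μ.withDensity fun z => ENNReal.ofReal (q z)))
    (hg0 : ∫ x, g x * q x ∂μ = 0) (hP : 0 < ∫ x, g x ^ 2 * q x ∂μ)
    (hS : Integrable (fun t => w t * ((∫ t', (1 - imhAcceptQ w q t t') * q t' ∂μ)
      / (1 - ∫ t', (1 - imhAcceptQ w q t t') * q t' ∂μ))) μ) :
    (Summable fun k => (∫ t, g t * ((imhOp μ w q)^[k + 1] g) t * w t ∂μ) / ∫ t, g t ^ 2 * w t ∂μ) ∧
    tauInt (fun k => (∫ t, g t * ((imhOp μ w q)^[k] g) t * w t ∂μ) / ∫ t, g t ^ 2 * w t ∂μ)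
      = 1 / 2 + (∫ t, w t * ((∫ t', (1 - imhAcceptQ w q t t') * q t' ∂μ)
          / (1 - ∫ t', (1 - imhAcceptQ w q t t') * q t' ∂μ)) ∂μ) / ∫ t, w t ∂μ := by
  set Z : ℝ := ∫ t, w t ∂μ with hZdef
  set V : ℝ := ∫ x, g x ^ 2 * q x ∂μ with hV
  have hZ : 0 < Z := integral_pos_of_pos hw0 hwi hq1
  have hA : ∫ t, g t ^ 2 * w t ∂μ = V * Z :=
    sqNorm_weightBlind hw0 hwm hq0 hqm hqi hq1 hℓ hβm hb hgm hgb hind hg0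
  have hterm : ∀ k, (∫ t, g t * ((imhOp μ w q)^[k + 1] g) t * w t ∂μ) / ∫ t, g t ^ 2 * w t ∂μ
      = (∫ t, w t * (∫ t', (1 - imhAcceptQ w q t t') * q t' ∂μ) ^ (k + 1) ∂μ) / Z := by
    intro k
    rw [autocov_weightBlind hw0 hwm hq0 hqm hqi hq1 hℓ hβm hb hgm hgb hind hg0 (k + 1), hA,
      mul_div_mul_left _ _ hP.ne']
  have h := (hasSum_weight_stickingMoments hw0 hwm hwi hq0 hqm hqi hq1 hS).div_const Z
  simp_rw [← hterm] at h
  refine ⟨h.summable, ?_⟩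
  unfold tauInt
  rw [h.tsum_eq]

end General

end Summit.Ventures.LatticeQCDFlow.Exactness
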